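import Summits.QuantumFields.YangMills.Theorems.FluctuationComparisonRegPrIntLOrganTangentAEDifferentiableFamily
import Summits.QuantumFields.YangMills.Theorems.FluctuationComparisonRegPrIntLOrganTangentLawResponseLip
import HarnessLib

/-!
# Crux `FluctuationComparisonRegPrIntL` (stmt-QuantumFields-20520, rung R3), PATH-B organ, H-currency cone — «THE LAW-RESPONSE ENGINES, AE EDITION»: the four (L27a) engines
# (law edge of a mean ∕ of a covariance, law square of a mean ∕ of a variance) WITHOUT the score witness `w′` and WITHOUT the pointwise-in-`s` differentiability clause (Diff₀):
# Lipschitz a.e.-`z` + joint measurability ⟹ absolutely continuous path functionals ⟹ FTC with kernels stated `∀ᵐ s` (TN-CUT-KINK-2, amendment A4 ∕ A2′; DEFINITION-FREE)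

Cell `ym3-torus` (YM ladder rung R3 = continuum `SU(2)` Yang–Mills on the three-torus — a RUNG: NOT d = 4, NOT infinite volume, NOT a mass gap, NOT Clay).
Width seat `ym-ust-20520-w3` (gen 27, LEAD-20520 organ-tangent lane); `--kind proof --supports stmt-QuantumFields-20520 --as helper`, count-neutral, no registry ∕ binder ∕
`Lines/` edit, default heartbeats, `autoImplicit false`.  Over ✓`…OrganTangentAEDifferentiableFamily` (this seat: Carathéodory measurability + Rademacher∕Fubini) and ✓(L27a)
`…OrganTangentLawResponseLip` (w5 g24: `hasDerivAt_normMean_of_lip`, `hasDerivAt_normCov_of_lip` — the pointwise-at-`s₀` responses, reused verbatim at a.e. `s₀`).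

WHY (A4 ∕ A2′, LEAD №3 (C); ★★OWNER RULING №83 (3)).  ✓(L27a)'s engines close the `[0,1]` law edge by the mean-value theorem from `HasDerivAt` at EVERY `s ∈ [0,1]`, which forces
the (I-law) blocks to carry a score witness `wN′`∕`w₁` and the clause (Diff₀) «`∀ s ∈ [0,1], ∀ᵐ z, HasDerivAt (s ↦ wNum … (X s) z) (wN′ s z) s`» — a kink-transversality fact
about the chart's fibres vs the ramps of `mwCut` and the cone point of `dist1`, NOT in print.  Here the same conclusions are reached from the a.e.-`z` LIPSCHITZ binders alone (plus
joint measurability of `(s, z) ↦ w s z`, free in the organ: `wNum` is measurable on `G_j × Z` and the law path is continuous): the normalised mean `s ↦ (∫ G·w_s)∕(∫ w_s)` is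
ABSOLUTELY CONTINUOUS on `[0,1]` (numerator and mass Lipschitz with constants `∫|b_G|`, `∫|b|`; mass continuous and non-vanishing on the compact interval ⟹ bounded away from `0` ⟹
its reciprocal Lipschitz; products of AC are AC), so `M 1 − M 0 = ∫₀¹ deriv M` (Mathlib `AbsolutelyContinuousOnInterval.integral_deriv_eq_sub`); at a.e. `s` the a.e.-`z` derivative
EXISTS (✓`ae_ae_hasDerivAt_deriv_of_lipschitzOn`), is fibre-measurable (a.e. limit of difference quotients), and ✓`hasDerivAt_normMean_of_lip` identifies `deriv M s` with the
score covariance; a kernel bound `∀ᵐ s` then bounds `|M 1 − M 0|`.  The score is the honest a.e. derivative `deriv (s ↦ w s z) s`; no witness is quantified.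

WHAT.  §1 ★`abs_sub_le_of_ac_of_ae_hasDerivAt` (AC on `[0,1]` + a.e. `HasDerivAt f (f′ s) s` + a.e. `|f′| ≤ ℓ` ⟹ `|f 1 − f 0| ≤ ℓ`); §2 `lipschitzOnWith_integral_of_ae_lip`,
`ac_integral_of_ae_lip`, `ac_inv_of_lipschitzOn`, ★`ac_normMean_of_lip`; §3 `aestronglyMeasurable_deriv_of_ae_hasDerivAt`, `aestronglyMeasurable_section`; §4 the engines
★★`abs_normMean_one_sub_zero_le_of_lip_ae`, ★★`abs_normCov_one_sub_zero_le_of_lip_ae`, ★★`abs_normMean_secondDiff_le_of_lip_ae`, ★★`abs_normVar_secondDiff_le_of_lip_ae` —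
CONCLUSIONS = ✓(L27a)'s character for character; BINDERS = ✓(L27a)'s with `hmeas'`∕`hm₁` and `hdiff`∕`hd₁` DELETED, `hmeas`∕`hm` STRENGTHENED to joint measurability
(`Measurable (fun p : ℝ × Z => w p.1 p.2)`, resp. per `s′`), `[SFinite τ]`, and the kernel hypotheses `hcov`∕`hcum`∕`hker` read `∀ᵐ s ∂volume, s ∈ Icc 0 1 → …` with `w′ s z` ↦
`deriv (fun s => w s z) s` (resp. `w₁ s s′ z` ↦ `deriv (fun s => w s s′ z) s`).

HONEST FRAMING: real analysis [folklore] over HYPOTHESIS shapes; every kernel input is a HYPOTHESIS («FIBRE-LAW CLUSTER BOUNDS»); nothing of Bałaban's analysis is asserted or proved;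
`SpreadFibreLawH(J)(sq)` ∕ `OrganDischargeInputsHJ(sq)` are UNDISCHARGED hypothesis rows; LIN″ ∕ JVAR″ ∕ JEN″ ∕ O1ᵘ-H v2.2 ∕ S1aᴴ ∕ S3ᴴ ∕ S2α′ ∕ S2β, the five registered stubs of
`Lines/semiclassical_s2beta.lean` (3732b7df, untouched), crux 20520 `FluctuationComparisonRegPrIntL` and `YM3TorusSU2` are NOT proved; rung R3 = SU(2) YM₃ on T³ at fixed lattice
data — NOT d = 4, NOT infinite volume, NOT a mass gap, NOT Clay; the Yang–Mills mass gap is NOT proved.  [folklore]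
-/

set_option autoImplicit false

noncomputable section

namespace Summit.QuantumFields.YangMills.Theorems.OrganTangentLawResponseLipAE

open MeasureTheory Filter Topology Set Function
open scoped NNReal Interval
open Summit.QuantumFields.YangMills.Theorems.OrganTangentLawResponseLip
open Summit.QuantumFields.YangMills.Theorems.OrganTangentAEDifferentiableFamily (ae_ae_hasDerivAt_deriv_of_lipschitzOn)

variable {Z : Type*} [MeasurableSpace Z] {τ : Measure Z}

/-! ## §1 The calculus core: an absolutely continuous path with an a.e. derivative bound -/

/-- ★ **AE EDITION of ✓`abs_sub_le_of_hasDerivAt_of_abs_le`.**  `f` absolutely continuous on `[0,1]`, `HasDerivAt f (f′ s) s` for a.e. `s ∈ [0,1]` and `|f′ s| ≤ ℓ` for a.e.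
`s ∈ [0,1]` ⟹ `|f 1 − f 0| ≤ ℓ` (FTC for absolutely continuous functions, Mathlib `AbsolutelyContinuousOnInterval.integral_deriv_eq_sub`). [folklore] -/
theorem abs_sub_le_of_ac_of_ae_hasDerivAt {f f' : ℝ → ℝ} {ℓ : ℝ} (hac : AbsolutelyContinuousOnInterval f 0 1)
    (hg : ∀ᵐ s ∂(volume : Measure ℝ), s ∈ Icc (0:ℝ) 1 → HasDerivAt f (f' s) s)
    (h : ∀ᵐ s ∂(volume : Measure ℝ), s ∈ Icc (0:ℝ) 1 → |f' s| ≤ ℓ) : |f 1 - f 0| ≤ ℓ := by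
  have hftc := hac.integral_deriv_eq_sub
  have hbound : ∀ᵐ x ∂(volume : Measure ℝ), x ∈ Ι (0:ℝ) 1 → ‖deriv f x‖ ≤ ℓ := by
    filter_upwards [hg, h] with x hx1 hx2 hxI
    rw [uIoc_of_le zero_le_one] at hxI
    have hxI' : x ∈ Icc (0:ℝ) 1 := ⟨hxI.1.le, hxI.2⟩
    rw [(hx1 hxI').deriv, Real.norm_eq_abs]
    exact hx2 hxI'
  have := intervalIntegral.norm_integral_le_of_norm_le_const_ae hbound
  rw [hftc, Real.norm_eq_abs, sub_zero, abs_one, mul_one] at this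
  exact this

/-! ## §2 Absolute continuity of fibre integrals and normalised means along an a.e.-Lipschitz path -/

/-- The `τ`-integral of an a.e.-Lipschitz-in-`s` family is Lipschitz on `[0,1]` with constant `∫ |b|`. [folklore] -/
theorem lipschitzOnWith_integral_of_ae_lip {F : ℝ → Z → ℝ} {U : Set ℝ} (hUI : Icc (0:ℝ) 1 ⊆ U) {b : Z → ℝ}
    (hlip : ∀ᵐ z ∂τ, LipschitzOnWith (Real.nnabs (b z)) (fun s => F s z) U) (hb : Integrable b τ)
    (hint : ∀ s ∈ Icc (0:ℝ) 1, Integrable (F s) τ) :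
    LipschitzOnWith (Real.toNNReal (∫ z, |b z| ∂τ)) (fun s => ∫ z, F s z ∂τ) (Icc (0:ℝ) 1) := by
  refine LipschitzOnWith.of_dist_le_mul fun s hs t ht => ?_
  rw [Real.dist_eq, ← integral_sub (hint s hs) (hint t ht), Real.coe_toNNReal _ (integral_nonneg fun z => abs_nonneg _), Real.dist_eq]
  calc |∫ z, F s z - F t z ∂τ| ≤ ∫ z, |F s z - F t z| ∂τ := abs_integral_le_integral_abs
    _ ≤ ∫ z, |b z| * |s - t| ∂τ := by
        refine integral_mono_ae ((hint s hs).sub (hint t ht)).abs (hb.abs.mul_const _) ?_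
        filter_upwards [hlip] with z hz
        have := hz.dist_le_mul s (hUI hs) t (hUI ht)
        rw [Real.dist_eq, Real.dist_eq, Real.coe_nnabs] at this
        exact this
    _ = (∫ z, |b z| ∂τ) * |s - t| := integral_mul_const _ _

/-- Hence absolutely continuous on `[0,1]`. [folklore] -/
theorem ac_integral_of_ae_lip {F : ℝ → Z → ℝ} {U : Set ℝ} (hUI : Icc (0:ℝ) 1 ⊆ U) {b : Z → ℝ}
    (hlip : ∀ᵐ z ∂τ, LipschitzOnWith (Real.nnabs (b z)) (fun s => F s z) U) (hb : Integrable b τ)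
    (hint : ∀ s ∈ Icc (0:ℝ) 1, Integrable (F s) τ) :
    AbsolutelyContinuousOnInterval (fun s => ∫ z, F s z ∂τ) 0 1 := by
  have h := lipschitzOnWith_integral_of_ae_lip hUI hlip hb hint
  rw [← uIcc_of_le zero_le_one] at h
  exact h.absolutelyContinuousOnInterval

/-- The reciprocal of a Lipschitz function that never vanishes on `[0,1]` is absolutely continuous there. [folklore] -/
theorem ac_inv_of_lipschitzOn {D : ℝ → ℝ} {K : ℝ≥0} (hD : LipschitzOnWith K D (Icc (0:ℝ) 1)) (hne : ∀ s ∈ Icc (0:ℝ) 1, D s ≠ 0) :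
    AbsolutelyContinuousOnInterval (fun s => (D s)⁻¹) 0 1 := by
  -- a positive lower bound for `|D|` on the compact interval
  obtain ⟨s₀, hs₀, hmin⟩ := isCompact_Icc.exists_isMinOn (nonempty_Icc.2 (zero_le_one : (0:ℝ) ≤ 1)) (hD.continuousOn.abs)
  set δ : ℝ := |D s₀| with hδ
  have hδ0 : 0 < δ := abs_pos.2 (hne s₀ hs₀)
  have hδle : ∀ s ∈ Icc (0:ℝ) 1, δ ≤ |D s| := fun s hs => hmin hs
  -- `x ↦ x⁻¹` is Lipschitz on `{δ ≤ |x|}`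
  have hinv : LipschitzOnWith (Real.toNNReal (1 / δ ^ 2)) (fun x : ℝ => x⁻¹) {x : ℝ | δ ≤ |x|} := by
    refine LipschitzOnWith.of_dist_le_mul fun x hx y hy => ?_
    have hx' : δ ≤ |x| := hx
    have hy' : δ ≤ |y| := hy
    have hx0 : x ≠ 0 := fun h0 => by rw [h0, abs_zero] at hx'; exact absurd hx' (not_le.2 hδ0)
    have hy0 : y ≠ 0 := fun h0 => by rw [h0, abs_zero] at hy'; exact absurd hy' (not_le.2 hδ0)
    rw [Real.dist_eq, Real.dist_eq, Real.coe_toNNReal _ (by positivity), inv_sub_inv hx0 hy0, abs_div, abs_mul, abs_sub_comm]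
    rw [div_le_iff₀ (by positivity)]
    have hxy : δ ^ 2 ≤ |x| * |y| := by nlinarith [hx', hy', abs_nonneg x, abs_nonneg y]
    calc |x - y| = 1 / δ ^ 2 * |x - y| * δ ^ 2 := by field_simp
      _ ≤ 1 / δ ^ 2 * |x - y| * (|x| * |y|) := by gcongr
  have hcomp := hinv.comp hD (fun s hs => hδle s hs)
  rw [← uIcc_of_le zero_le_one] at hcomp
  exact hcomp.absolutelyContinuousOnInterval

/-- ★ **THE NORMALISED MEAN IS ABSOLUTELY CONTINUOUS ALONG AN A.E.-LIPSCHITZ LAW PATH.**  `s ↦ (∫ G·w_s)∕(∫ w_s)` on `[0,1]`, from the a.e. Lipschitz binders of `w` and `G·w`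
(integrable constants), integrability on `[0,1]` and non-vanishing masses. [folklore] -/
theorem ac_normMean_of_lip {w : ℝ → Z → ℝ} {G : Z → ℝ} {U : Set ℝ} (hUI : Icc (0:ℝ) 1 ⊆ U)
    (hint : ∀ s ∈ Icc (0:ℝ) 1, Integrable (w s) τ) (hintG : ∀ s ∈ Icc (0:ℝ) 1, Integrable (fun z => G z * w s z) τ)
    {bound : Z → ℝ} (hlip : ∀ᵐ z ∂τ, LipschitzOnWith (Real.nnabs (bound z)) (fun s => w s z) U) (hbint : Integrable bound τ)
    {boundG : Z → ℝ} (hlipG : ∀ᵐ z ∂τ, LipschitzOnWith (Real.nnabs (boundG z)) (fun s => G z * w s z) U) (hbGint : Integrable boundG τ)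
    (hZ : ∀ s ∈ Icc (0:ℝ) 1, ∫ z, w s z ∂τ ≠ 0) :
    AbsolutelyContinuousOnInterval (fun s => (∫ z, G z * w s z ∂τ) / (∫ z, w s z ∂τ)) 0 1 := by
  have hN := ac_integral_of_ae_lip (F := fun s z => G z * w s z) hUI hlipG hbGint hintG
  have hL := lipschitzOnWith_integral_of_ae_lip (F := w) hUI hlip hbint hint
  have hI := ac_inv_of_lipschitzOn hL hZ
  have e : (fun s => (∫ z, G z * w s z ∂τ) / (∫ z, w s z ∂τ)) = (fun s => ∫ z, G z * w s z ∂τ) * (fun s => (∫ z, w s z ∂τ)⁻¹) := by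
    funext s; simp only [Pi.mul_apply, div_eq_mul_inv]
  rw [e]
  exact hN.mul hI

/-! ## §3 Measurability of the a.e. derivative -/

/-- At a parameter `s` where `τ`-a.e. path is differentiable, `z ↦ deriv (w · z) s` is a.e.-strongly measurable (a.e. limit of difference quotients). [folklore] -/
theorem aestronglyMeasurable_deriv_of_ae_hasDerivAt {w : ℝ → Z → ℝ} {s : ℝ} (hmeas : ∀ s, AEStronglyMeasurable (w s) τ)
    (hd : ∀ᵐ z ∂τ, HasDerivAt (fun s => w s z) (deriv (fun s => w s z) s) s) :
    AEStronglyMeasurable (fun z => deriv (fun s => w s z) s) τ := by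
  set u : ℕ → ℝ := fun n => 1 / ((n : ℝ) + 1) with hu
  have hu0 : Tendsto u atTop (𝓝[≠] (0 : ℝ)) := by
    refine tendsto_nhdsWithin_iff.2 ⟨tendsto_one_div_add_atTop_nhds_zero_nat, Eventually.of_forall fun n => ?_⟩
    rw [mem_compl_iff, mem_singleton_iff, hu]; positivity
  refine aestronglyMeasurable_of_tendsto_ae atTop (f := fun n z => (u n)⁻¹ • (w (s + u n) z - w s z)) (fun n => ?_) ?_
  · exact ((hmeas (s + u n)).sub (hmeas s)).const_smul ((u n)⁻¹)
  · filter_upwards [hd] with z hz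
    rw [hasDerivAt_iff_tendsto_slope_zero] at hz
    exact hz.comp hu0

/-- Joint measurability gives measurability of every section. [folklore] -/
theorem aestronglyMeasurable_section {w : ℝ → Z → ℝ} (hwm : Measurable (fun p : ℝ × Z => w p.1 p.2)) (s : ℝ) :
    AEStronglyMeasurable (w s) τ :=
  (hwm.comp measurable_prodMk_left).aestronglyMeasurable

/-! ## §4 ★★ The four law-response engines, AE editions (no `w′` witness, no pointwise-in-`s` differentiability; kernels `∀ᵐ s`) -/

/-- ★★ **LAW EDGE OF A FROZEN-INTEGRAND MEAN, AE EDITION** (conclusion = ✓`abs_normMean_one_sub_zero_le_of_lip`'s; binders: its `hmeas'`∕`hdiff` DELETED, `hmeas` ↦ joint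
measurability, kernel `∀ᵐ s` with the score `deriv (w · z) s`). [folklore] -/
theorem abs_normMean_one_sub_zero_le_of_lip_ae [SFinite τ] {w : ℝ → Z → ℝ} {G : Z → ℝ} {U : Set ℝ} (hU : IsOpen U) (hUI : Icc (0:ℝ) 1 ⊆ U)
    (hG : AEStronglyMeasurable G τ) (hwm : Measurable (fun p : ℝ × Z => w p.1 p.2))
    (hint : ∀ s ∈ Icc (0:ℝ) 1, Integrable (w s) τ) (hintG : ∀ s ∈ Icc (0:ℝ) 1, Integrable (fun z => G z * w s z) τ)
    {bound : Z → ℝ} (hlip : ∀ᵐ z ∂τ, LipschitzOnWith (Real.nnabs (bound z)) (fun s => w s z) U) (hbint : Integrable bound τ)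
    {boundG : Z → ℝ} (hlipG : ∀ᵐ z ∂τ, LipschitzOnWith (Real.nnabs (boundG z)) (fun s => G z * w s z) U) (hbGint : Integrable boundG τ)
    (hZ : ∀ s ∈ Icc (0:ℝ) 1, ∫ z, w s z ∂τ ≠ 0) {ℓ : ℝ}
    (hcov : ∀ᵐ s ∂(volume : Measure ℝ), s ∈ Icc (0:ℝ) 1 →
      |(∫ z, G z * deriv (fun s => w s z) s ∂τ) / (∫ z, w s z ∂τ)
        - ((∫ z, G z * w s z ∂τ) / (∫ z, w s z ∂τ)) * ((∫ z, deriv (fun s => w s z) s ∂τ) / (∫ z, w s z ∂τ))| ≤ ℓ) :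
    |(∫ z, G z * w 1 z ∂τ) / (∫ z, w 1 z ∂τ) - (∫ z, G z * w 0 z ∂τ) / (∫ z, w 0 z ∂τ)| ≤ ℓ := by
  have hmeas : ∀ s, AEStronglyMeasurable (w s) τ := aestronglyMeasurable_section hwm
  have hD := ae_ae_hasDerivAt_deriv_of_lipschitzOn hU hUI τ hwm hlip
  refine abs_sub_le_of_ac_of_ae_hasDerivAt (ac_normMean_of_lip hUI hint hintG hlip hbint hlipG hbGint hZ) ?_ hcov
  filter_upwards [hD] with s hs hsI
  have hd := hs hsI
  exact hasDerivAt_normMean_of_lip (w'₀ := fun z => deriv (fun s => w s z) s) (hU.mem_nhds (hUI hsI)) hG hmeas (hint s hsI) (hintG s hsI)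
    (aestronglyMeasurable_deriv_of_ae_hasDerivAt hmeas hd) hlip hbint hlipG hbGint hd (hZ s hsI)


/-- ★★ **LAW EDGE OF A COVARIANCE, AE EDITION** (conclusion = ✓`abs_normCov_one_sub_zero_le_of_lip`'s). [folklore] -/
theorem abs_normCov_one_sub_zero_le_of_lip_ae [SFinite τ] {w : ℝ → Z → ℝ} {A B : Z → ℝ} {U : Set ℝ} (hU : IsOpen U) (hUI : Icc (0:ℝ) 1 ⊆ U)
    (hA : AEStronglyMeasurable A τ) (hB : AEStronglyMeasurable B τ) (hwm : Measurable (fun p : ℝ × Z => w p.1 p.2))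
    (hint : ∀ s ∈ Icc (0:ℝ) 1, Integrable (w s) τ) (hintA : ∀ s ∈ Icc (0:ℝ) 1, Integrable (fun z => A z * w s z) τ)
    (hintB : ∀ s ∈ Icc (0:ℝ) 1, Integrable (fun z => B z * w s z) τ)
    (hintAB : ∀ s ∈ Icc (0:ℝ) 1, Integrable (fun z => (A z * B z) * w s z) τ)
    {bound : Z → ℝ} (hlip : ∀ᵐ z ∂τ, LipschitzOnWith (Real.nnabs (bound z)) (fun s => w s z) U) (hbint : Integrable bound τ)
    {boundA : Z → ℝ} (hlipA : ∀ᵐ z ∂τ, LipschitzOnWith (Real.nnabs (boundA z)) (fun s => A z * w s z) U) (hbAint : Integrable boundA τ)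
    {boundB : Z → ℝ} (hlipB : ∀ᵐ z ∂τ, LipschitzOnWith (Real.nnabs (boundB z)) (fun s => B z * w s z) U) (hbBint : Integrable boundB τ)
    {boundAB : Z → ℝ} (hlipAB : ∀ᵐ z ∂τ, LipschitzOnWith (Real.nnabs (boundAB z)) (fun s => (A z * B z) * w s z) U) (hbABint : Integrable boundAB τ)
    (hZ : ∀ s ∈ Icc (0:ℝ) 1, ∫ z, w s z ∂τ ≠ 0) {ℓ : ℝ}
    (hcum : ∀ᵐ s ∂(volume : Measure ℝ), s ∈ Icc (0:ℝ) 1 →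
      |((∫ z, (A z * B z) * deriv (fun s => w s z) s ∂τ) / (∫ z, w s z ∂τ)
          - ((∫ z, (A z * B z) * w s z ∂τ) / (∫ z, w s z ∂τ)) * ((∫ z, deriv (fun s => w s z) s ∂τ) / (∫ z, w s z ∂τ)))
        - (((∫ z, A z * deriv (fun s => w s z) s ∂τ) / (∫ z, w s z ∂τ)
              - ((∫ z, A z * w s z ∂τ) / (∫ z, w s z ∂τ)) * ((∫ z, deriv (fun s => w s z) s ∂τ) / (∫ z, w s z ∂τ)))
            * ((∫ z, B z * w s z ∂τ) / (∫ z, w s z ∂τ))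
          + ((∫ z, A z * w s z ∂τ) / (∫ z, w s z ∂τ))
            * ((∫ z, B z * deriv (fun s => w s z) s ∂τ) / (∫ z, w s z ∂τ)
              - ((∫ z, B z * w s z ∂τ) / (∫ z, w s z ∂τ)) * ((∫ z, deriv (fun s => w s z) s ∂τ) / (∫ z, w s z ∂τ))))| ≤ ℓ) :
    |((∫ z, (A z * B z) * w 1 z ∂τ) / (∫ z, w 1 z ∂τ)
        - ((∫ z, A z * w 1 z ∂τ) / (∫ z, w 1 z ∂τ)) * ((∫ z, B z * w 1 z ∂τ) / (∫ z, w 1 z ∂τ)))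
      - ((∫ z, (A z * B z) * w 0 z ∂τ) / (∫ z, w 0 z ∂τ)
        - ((∫ z, A z * w 0 z ∂τ) / (∫ z, w 0 z ∂τ)) * ((∫ z, B z * w 0 z ∂τ) / (∫ z, w 0 z ∂τ)))| ≤ ℓ := by
  have hmeas : ∀ s, AEStronglyMeasurable (w s) τ := aestronglyMeasurable_section hwm
  have hD := ae_ae_hasDerivAt_deriv_of_lipschitzOn hU hUI τ hwm hlip
  have hac : AbsolutelyContinuousOnInterval (fun s => (∫ z, (A z * B z) * w s z ∂τ) / (∫ z, w s z ∂τ)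
      - ((∫ z, A z * w s z ∂τ) / (∫ z, w s z ∂τ)) * ((∫ z, B z * w s z ∂τ) / (∫ z, w s z ∂τ))) 0 1 :=
    (ac_normMean_of_lip hUI hint hintAB hlip hbint hlipAB hbABint hZ).sub
      ((ac_normMean_of_lip hUI hint hintA hlip hbint hlipA hbAint hZ).mul (ac_normMean_of_lip hUI hint hintB hlip hbint hlipB hbBint hZ))
  refine abs_sub_le_of_ac_of_ae_hasDerivAt hac ?_ hcum
  filter_upwards [hD] with s hs hsI
  have hd := hs hsI
  exact hasDerivAt_normCov_of_lip (w'₀ := fun z => deriv (fun s => w s z) s) (hU.mem_nhds (hUI hsI)) hA hB hmeas (hint s hsI) (hintA s hsI)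
    (hintB s hsI) (hintAB s hsI) (aestronglyMeasurable_deriv_of_ae_hasDerivAt hmeas hd) hlip hbint hlipA hbAint hlipB hbBint hlipAB hbABint hd (hZ s hsI)

/-- ★★ **LAW SQUARE OF A FROZEN-INTEGRAND MEAN, AE EDITION** (conclusion = ✓`abs_normMean_secondDiff_le_of_lip`'s; two-parameter family `w s s′ z`, measurability of
`(s, z) ↦ w s s′ z` for every `s′`, NO `w₁` witness, kernel `∀ᵐ s` with the scores `deriv (w · s′ z) s`, `s′ ∈ {0, 1}`). [folklore] -/
theorem abs_normMean_secondDiff_le_of_lip_ae [SFinite τ] {w : ℝ → ℝ → Z → ℝ} {G : Z → ℝ} {U : Set ℝ} (hU : IsOpen U) (hUI : Icc (0:ℝ) 1 ⊆ U)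
    (hG : AEStronglyMeasurable G τ) (hwm : ∀ s', Measurable (fun p : ℝ × Z => w p.1 s' p.2))
    (hi : ∀ s ∈ Icc (0:ℝ) 1, ∀ s' ∈ Icc (0:ℝ) 1, Integrable (w s s') τ)
    (hiG : ∀ s ∈ Icc (0:ℝ) 1, ∀ s' ∈ Icc (0:ℝ) 1, Integrable (fun z => G z * w s s' z) τ)
    {b₁ : Z → ℝ} (hlip : ∀ s' ∈ Icc (0:ℝ) 1, ∀ᵐ z ∂τ, LipschitzOnWith (Real.nnabs (b₁ z)) (fun s => w s s' z) U) (hb₁i : Integrable b₁ τ)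
    {b₁G : Z → ℝ} (hlipG : ∀ s' ∈ Icc (0:ℝ) 1, ∀ᵐ z ∂τ, LipschitzOnWith (Real.nnabs (b₁G z)) (fun s => G z * w s s' z) U) (hb₁Gi : Integrable b₁G τ)
    (hZ : ∀ s ∈ Icc (0:ℝ) 1, ∀ s' ∈ Icc (0:ℝ) 1, ∫ z, w s s' z ∂τ ≠ 0) {ℓ : ℝ}
    (hker : ∀ᵐ s ∂(volume : Measure ℝ), s ∈ Icc (0:ℝ) 1 →
      |((∫ z, G z * deriv (fun s => w s 1 z) s ∂τ) / (∫ z, w s 1 z ∂τ)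
          - ((∫ z, G z * w s 1 z ∂τ) / (∫ z, w s 1 z ∂τ)) * ((∫ z, deriv (fun s => w s 1 z) s ∂τ) / (∫ z, w s 1 z ∂τ)))
        - ((∫ z, G z * deriv (fun s => w s 0 z) s ∂τ) / (∫ z, w s 0 z ∂τ)
          - ((∫ z, G z * w s 0 z ∂τ) / (∫ z, w s 0 z ∂τ)) * ((∫ z, deriv (fun s => w s 0 z) s ∂τ) / (∫ z, w s 0 z ∂τ)))| ≤ ℓ) :
    |(∫ z, G z * w 1 1 z ∂τ) / (∫ z, w 1 1 z ∂τ) - (∫ z, G z * w 1 0 z ∂τ) / (∫ z, w 1 0 z ∂τ)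
      - (∫ z, G z * w 0 1 z ∂τ) / (∫ z, w 0 1 z ∂τ) + (∫ z, G z * w 0 0 z ∂τ) / (∫ z, w 0 0 z ∂τ)| ≤ ℓ := by
  have h1 : (1:ℝ) ∈ Icc (0:ℝ) 1 := ⟨zero_le_one, le_rfl⟩
  have h0 : (0:ℝ) ∈ Icc (0:ℝ) 1 := ⟨le_rfl, zero_le_one⟩
  have hmeas : ∀ s s', AEStronglyMeasurable (w s s') τ := fun s s' => aestronglyMeasurable_section (w := fun s z => w s s' z) (hwm s') s
  have hD1 := ae_ae_hasDerivAt_deriv_of_lipschitzOn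
    (w := fun s z => w s 1 z) hU hUI τ (hwm 1) (hlip 1 h1)
  have hD0 := ae_ae_hasDerivAt_deriv_of_lipschitzOn
    (w := fun s z => w s 0 z) hU hUI τ (hwm 0) (hlip 0 h0)
  have hac : AbsolutelyContinuousOnInterval
      (fun s => (∫ z, G z * w s 1 z ∂τ) / (∫ z, w s 1 z ∂τ) - (∫ z, G z * w s 0 z ∂τ) / (∫ z, w s 0 z ∂τ)) 0 1 :=
    (ac_normMean_of_lip (w := fun s z => w s 1 z) hUI (fun s hs => hi s hs 1 h1) (fun s hs => hiG s hs 1 h1) (hlip 1 h1) hb₁i (hlipG 1 h1) hb₁Gi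
        (fun s hs => hZ s hs 1 h1)).sub
      (ac_normMean_of_lip (w := fun s z => w s 0 z) hUI (fun s hs => hi s hs 0 h0) (fun s hs => hiG s hs 0 h0) (hlip 0 h0) hb₁i (hlipG 0 h0) hb₁Gi
        (fun s hs => hZ s hs 0 h0))
  have h := abs_sub_le_of_ac_of_ae_hasDerivAt hac ?_ hker
  · have e : (∫ z, G z * w 1 1 z ∂τ) / (∫ z, w 1 1 z ∂τ) - (∫ z, G z * w 1 0 z ∂τ) / (∫ z, w 1 0 z ∂τ)
        - ((∫ z, G z * w 0 1 z ∂τ) / (∫ z, w 0 1 z ∂τ) - (∫ z, G z * w 0 0 z ∂τ) / (∫ z, w 0 0 z ∂τ))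
        = (∫ z, G z * w 1 1 z ∂τ) / (∫ z, w 1 1 z ∂τ) - (∫ z, G z * w 1 0 z ∂τ) / (∫ z, w 1 0 z ∂τ)
          - (∫ z, G z * w 0 1 z ∂τ) / (∫ z, w 0 1 z ∂τ) + (∫ z, G z * w 0 0 z ∂τ) / (∫ z, w 0 0 z ∂τ) := by ring
    rwa [e] at h
  filter_upwards [hD1, hD0] with s hs1 hs0 hsI
  have hd1 := hs1 hsI
  have hd0 := hs0 hsI
  exact (hasDerivAt_normMean_of_lip (w := fun s => w s 1) (w'₀ := fun z => deriv (fun s => w s 1 z) s) (hU.mem_nhds (hUI hsI)) hG (fun s => hmeas s 1)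
      (hi s hsI 1 h1) (hiG s hsI 1 h1) (aestronglyMeasurable_deriv_of_ae_hasDerivAt (fun s => hmeas s 1) hd1) (hlip 1 h1) hb₁i (hlipG 1 h1) hb₁Gi
      hd1 (hZ s hsI 1 h1)).sub
    (hasDerivAt_normMean_of_lip (w := fun s => w s 0) (w'₀ := fun z => deriv (fun s => w s 0 z) s) (hU.mem_nhds (hUI hsI)) hG (fun s => hmeas s 0)
      (hi s hsI 0 h0) (hiG s hsI 0 h0) (aestronglyMeasurable_deriv_of_ae_hasDerivAt (fun s => hmeas s 0) hd0) (hlip 0 h0) hb₁i (hlipG 0 h0) hb₁Gi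
      hd0 (hZ s hsI 0 h0))

/-- ★★ **VARIANCE SQUARE, AE EDITION** (conclusion = ✓`abs_normVar_secondDiff_le_of_lip`'s; binders `φ ψ Dφ Dψ` with defining equations, `Dφ`, `Dψ` now read with the scores
`deriv (w · s′ z) s`; NO `w₁` witness; kernel `∀ᵐ s`). [folklore] -/
theorem abs_normVar_secondDiff_le_of_lip_ae [SFinite τ] {w : ℝ → ℝ → Z → ℝ} {Fo : Z → ℝ} {U : Set ℝ} (hU : IsOpen U) (hUI : Icc (0:ℝ) 1 ⊆ U)
    (hFo : AEStronglyMeasurable Fo τ) (hwm : ∀ s', Measurable (fun p : ℝ × Z => w p.1 s' p.2))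
    (hi : ∀ s ∈ Icc (0:ℝ) 1, ∀ s' ∈ Icc (0:ℝ) 1, Integrable (w s s') τ)
    (hiF : ∀ s ∈ Icc (0:ℝ) 1, ∀ s' ∈ Icc (0:ℝ) 1, Integrable (fun z => Fo z * w s s' z) τ)
    (hiFF : ∀ s ∈ Icc (0:ℝ) 1, ∀ s' ∈ Icc (0:ℝ) 1, Integrable (fun z => (Fo z * Fo z) * w s s' z) τ)
    {b₁ : Z → ℝ} (hlip : ∀ s' ∈ Icc (0:ℝ) 1, ∀ᵐ z ∂τ, LipschitzOnWith (Real.nnabs (b₁ z)) (fun s => w s s' z) U) (hb₁i : Integrable b₁ τ)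
    {b₁F : Z → ℝ} (hlipF : ∀ s' ∈ Icc (0:ℝ) 1, ∀ᵐ z ∂τ, LipschitzOnWith (Real.nnabs (b₁F z)) (fun s => Fo z * w s s' z) U) (hb₁Fi : Integrable b₁F τ)
    {b₁FF : Z → ℝ} (hlipFF : ∀ s' ∈ Icc (0:ℝ) 1, ∀ᵐ z ∂τ, LipschitzOnWith (Real.nnabs (b₁FF z)) (fun s => (Fo z * Fo z) * w s s' z) U) (hb₁FFi : Integrable b₁FF τ)
    (hZ : ∀ s ∈ Icc (0:ℝ) 1, ∀ s' ∈ Icc (0:ℝ) 1, ∫ z, w s s' z ∂τ ≠ 0)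
    (φ ψ Dφ Dψ : ℝ → ℝ → ℝ)
    (hφ : ∀ s s', φ s s' = (∫ z, Fo z * w s s' z ∂τ) / (∫ z, w s s' z ∂τ))
    (hψ : ∀ s s', ψ s s' = (∫ z, (Fo z * Fo z) * w s s' z ∂τ) / (∫ z, w s s' z ∂τ))
    (hDφ : ∀ s s', Dφ s s' = (∫ z, Fo z * deriv (fun s => w s s' z) s ∂τ) / (∫ z, w s s' z ∂τ)
      - ((∫ z, Fo z * w s s' z ∂τ) / (∫ z, w s s' z ∂τ)) * ((∫ z, deriv (fun s => w s s' z) s ∂τ) / (∫ z, w s s' z ∂τ)))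
    (hDψ : ∀ s s', Dψ s s' = (∫ z, (Fo z * Fo z) * deriv (fun s => w s s' z) s ∂τ) / (∫ z, w s s' z ∂τ)
      - ((∫ z, (Fo z * Fo z) * w s s' z ∂τ) / (∫ z, w s s' z ∂τ)) * ((∫ z, deriv (fun s => w s s' z) s ∂τ) / (∫ z, w s s' z ∂τ)))
    {ℓ : ℝ} (hker : ∀ᵐ s ∂(volume : Measure ℝ), s ∈ Icc (0:ℝ) 1 →
      |(Dψ s 1 - (Dφ s 1 * φ s 1 + φ s 1 * Dφ s 1)) - (Dψ s 0 - (Dφ s 0 * φ s 0 + φ s 0 * Dφ s 0))| ≤ ℓ) :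
    |(ψ 1 1 - φ 1 1 * φ 1 1) - (ψ 1 0 - φ 1 0 * φ 1 0) - (ψ 0 1 - φ 0 1 * φ 0 1) + (ψ 0 0 - φ 0 0 * φ 0 0)| ≤ ℓ := by
  have h1 : (1:ℝ) ∈ Icc (0:ℝ) 1 := ⟨zero_le_one, le_rfl⟩
  have h0 : (0:ℝ) ∈ Icc (0:ℝ) 1 := ⟨le_rfl, zero_le_one⟩
  have hFF : AEStronglyMeasurable (fun z => Fo z * Fo z) τ := hFo.mul hFo
  have hmeas : ∀ s s', AEStronglyMeasurable (w s s') τ := fun s s' => aestronglyMeasurable_section (w := fun s z => w s s' z) (hwm s') s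
  -- absolute continuity of `φ(·, s′)`, `ψ(·, s′)` for `s′ ∈ [0,1]`
  have acφ : ∀ s' ∈ Icc (0:ℝ) 1, AbsolutelyContinuousOnInterval (fun s => φ s s') 0 1 := by
    intro s' hs'
    have e : (fun s => φ s s') = fun s => (∫ z, Fo z * w s s' z ∂τ) / (∫ z, w s s' z ∂τ) := funext fun s => hφ s s'
    rw [e]
    exact ac_normMean_of_lip (w := fun s z => w s s' z) hUI (fun s hs => hi s hs s' hs') (fun s hs => hiF s hs s' hs') (hlip s' hs') hb₁i
      (hlipF s' hs') hb₁Fi (fun s hs => hZ s hs s' hs')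
  have acψ : ∀ s' ∈ Icc (0:ℝ) 1, AbsolutelyContinuousOnInterval (fun s => ψ s s') 0 1 := by
    intro s' hs'
    have e : (fun s => ψ s s') = fun s => (∫ z, (Fo z * Fo z) * w s s' z ∂τ) / (∫ z, w s s' z ∂τ) := funext fun s => hψ s s'
    rw [e]
    exact ac_normMean_of_lip (w := fun s z => w s s' z) hUI (fun s hs => hi s hs s' hs') (fun s hs => hiFF s hs s' hs') (hlip s' hs') hb₁i
      (hlipFF s' hs') hb₁FFi (fun s hs => hZ s hs s' hs')
  have hac : AbsolutelyContinuousOnInterval (fun s => (ψ s 1 - φ s 1 * φ s 1) - (ψ s 0 - φ s 0 * φ s 0)) 0 1 :=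
    ((acψ 1 h1).sub ((acφ 1 h1).mul (acφ 1 h1))).sub ((acψ 0 h0).sub ((acφ 0 h0).mul (acφ 0 h0)))
  -- a.e. differentiability in `s` at `s′ = 0, 1`
  have hD1 := ae_ae_hasDerivAt_deriv_of_lipschitzOn
    (w := fun s z => w s 1 z) hU hUI τ (hwm 1) (hlip 1 h1)
  have hD0 := ae_ae_hasDerivAt_deriv_of_lipschitzOn
    (w := fun s z => w s 0 z) hU hUI τ (hwm 0) (hlip 0 h0)
  -- the responses at an a.e. `s`
  have dφ : ∀ s ∈ Icc (0:ℝ) 1, ∀ s' ∈ Icc (0:ℝ) 1, (∀ᵐ z ∂τ, HasDerivAt (fun s => w s s' z) (deriv (fun s => w s s' z) s) s) →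
      HasDerivAt (fun s => φ s s') (Dφ s s') s := by
    intro s hs s' hs' hd
    have e : (fun s => φ s s') = fun s => (∫ z, Fo z * w s s' z ∂τ) / (∫ z, w s s' z ∂τ) := funext fun s => hφ s s'
    rw [e, hDφ]
    exact hasDerivAt_normMean_of_lip (w := fun s => w s s') (w'₀ := fun z => deriv (fun s => w s s' z) s) (hU.mem_nhds (hUI hs)) hFo
      (fun s => hmeas s s') (hi s hs s' hs') (hiF s hs s' hs') (aestronglyMeasurable_deriv_of_ae_hasDerivAt (fun s => hmeas s s') hd)
      (hlip s' hs') hb₁i (hlipF s' hs') hb₁Fi hd (hZ s hs s' hs')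
  have dψ : ∀ s ∈ Icc (0:ℝ) 1, ∀ s' ∈ Icc (0:ℝ) 1, (∀ᵐ z ∂τ, HasDerivAt (fun s => w s s' z) (deriv (fun s => w s s' z) s) s) →
      HasDerivAt (fun s => ψ s s') (Dψ s s') s := by
    intro s hs s' hs' hd
    have e : (fun s => ψ s s') = fun s => (∫ z, (Fo z * Fo z) * w s s' z ∂τ) / (∫ z, w s s' z ∂τ) := funext fun s => hψ s s'
    rw [e, hDψ]
    exact hasDerivAt_normMean_of_lip (w := fun s => w s s') (w'₀ := fun z => deriv (fun s => w s s' z) s) (hU.mem_nhds (hUI hs)) hFF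
      (fun s => hmeas s s') (hi s hs s' hs') (hiFF s hs s' hs') (aestronglyMeasurable_deriv_of_ae_hasDerivAt (fun s => hmeas s s') hd)
      (hlip s' hs') hb₁i (hlipFF s' hs') hb₁FFi hd (hZ s hs s' hs')
  have h := abs_sub_le_of_ac_of_ae_hasDerivAt hac ?_ hker
  · have e : (ψ 1 1 - φ 1 1 * φ 1 1) - (ψ 1 0 - φ 1 0 * φ 1 0) - ((ψ 0 1 - φ 0 1 * φ 0 1) - (ψ 0 0 - φ 0 0 * φ 0 0))
        = (ψ 1 1 - φ 1 1 * φ 1 1) - (ψ 1 0 - φ 1 0 * φ 1 0) - (ψ 0 1 - φ 0 1 * φ 0 1) + (ψ 0 0 - φ 0 0 * φ 0 0) := by ring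
    rwa [e] at h
  filter_upwards [hD1, hD0] with s hs1 hs0 hsI
  exact ((dψ s hsI 1 h1 (hs1 hsI)).sub ((dφ s hsI 1 h1 (hs1 hsI)).mul (dφ s hsI 1 h1 (hs1 hsI)))).sub
    ((dψ s hsI 0 h0 (hs0 hsI)).sub ((dφ s hsI 0 h0 (hs0 hsI)).mul (dφ s hsI 0 h0 (hs0 hsI))))

end Summit.QuantumFields.YangMills.Theorems.OrganTangentLawResponseLipAE

end
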